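import Summits.Schanuel.Schanuel.Theorems.ZilberEacAnalyticPuiseuxRoot
import Summits.Schanuel.Schanuel.Theorems.ZilberEacPlaneCurveRows
import Mathlib.RingTheory.Polynomial.Resultant.Basic
import HarnessLib

/-!
# Arbitrary base branches, XCII: PUISEUX PARAMETRISATION OF A FIBRE CURVE ALONG A PLACE — the
# crux of O89: `P(x₀(s), x₁(s); y) = 0` has a root `y = ψ(σ)σ^L`, `ψ(0) ≠ 0`, `s = σ^e`

HONEST FRAMING.  Cell `pub-schanuel` (Zilber's Exponential-Algebraic Closedness, case ladder;
host summit Schanuel), seat 2, gen 33.  A surface of Mantova–Masser's case fibred in CURVES over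
a plane curve `C : F(x₀, x₁) = 0` is `{x ∈ C, P(x₀, x₁; y₀) = 0}` for a polynomial
`P ∈ ℂ[x₀, x₁][y]`.  The germ theorems (files LXVII, LXXXIII) need, along a place
`x₀ = s^{-k}`, `x₁ = Φ(s)s^{-M}` of `C`, a fibre value of the shape `y₀ = ψ(σ)σ^L` (`ψ` analytic,
`ψ(0) ≠ 0`, `s = σ^e`) with `P(x(σ^e); y₀) = 0`.  **`exists_fibreCurve_puiseuxRoot`** supplies it
for every `P` of positive `y`-degree whose top and bottom coefficients and whose `y`-discriminant
(`Polynomial.resultant P ∂_yP`) are not divisible by `F`: the rows `P_j(x(s))` are meromorphic at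
`s = 0` (`exists_rows_place_normalForm`, gen 31), cleared to analytic rows by a power of `s`; the
universal identity `P·p + ∂_yP·q = Res_y(P, ∂_yP)` (Mathlib) evaluated along the place is the
Bézout element; the analytic Newton–Puiseux theorem (file XCI) gives the root.  [folklore
(Newton–Puiseux), made concrete]; nothing here is specific to Schanuel's conjecture (neither used
nor implied); Mantova–Masser's question (PLMS 2024 §1 p. 5) and EC(3,2) stay OPEN; EAC ⇏ SC.
-/

noncomputable section

open Filter Topology Polynomial

set_option linter.dupNamespace false

namespace Summit.Schanuel.Schanuel.Theorems

section FibreCurvePuiseux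

variable (F : ℂ[X][X])

/-! ## Part A. Evaluations as row sums; rows along a place -/

/-- `(P.map f)(y) = Σ_{j ≤ d} f(P_j) y^j` for `P` of degree `≤ d`. [folklore] -/
theorem eval_map_eq_rowSum {R' : Type*} [CommRing R'] (P : Polynomial R') (f : R' →+* ℂ) {d : ℕ}
    (hd : P.natDegree ≤ d) (y : ℂ) :
    (P.map f).eval y = ∑ j ∈ Finset.range (d + 1), f (P.coeff j) * y ^ j := by
  have hdeg : (P.map f).natDegree < d + 1 :=
    lt_of_le_of_lt (Polynomial.natDegree_map_le) (Nat.lt_succ_of_le hd)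
  rw [(P.map f).as_sum_range_C_mul_X_pow' hdeg, eval_rowPoly]
  simp only [Polynomial.coeff_map]

/-- `(∂P.map f)(y) = Σ_{j ≤ d} j f(P_j) y^{j-1}` for `P` of degree `≤ d`. [folklore] -/
theorem eval_derivative_map_eq_rowSum {R' : Type*} [CommRing R'] (P : Polynomial R')
    (f : R' →+* ℂ) {d : ℕ} (hd : P.natDegree ≤ d) (y : ℂ) :
    ((derivative P).map f).eval y =
      ∑ j ∈ Finset.range (d + 1), (j : ℂ) * f (P.coeff j) * y ^ (j - 1) := by
  have hdeg : (P.map f).natDegree < d + 1 :=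
    lt_of_le_of_lt (Polynomial.natDegree_map_le) (Nat.lt_succ_of_le hd)
  rw [← Polynomial.derivative_map, (P.map f).as_sum_range_C_mul_X_pow' hdeg,
    eval_derivative_rowPoly]
  simp only [Polynomial.coeff_map]

/-- **A row along a place.**  For every `G ∈ ℂ[x₀][x₁]` there are `ψ` analytic at `0` and `L ∈ ℤ`
with `G(s^{-k}, Φ(s)s^{-M}) = ψ(s)s^L` for small `s ≠ 0`, and `ψ(0) ≠ 0` unless `F ∣ G`.
[folklore] -/
theorem exists_row_along_place (hFirr : Irreducible F) (hn : 1 ≤ F.natDegree) {k : ℕ} (hk : 1 ≤ k)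
    (M : ℕ) {Φ : ℂ → ℂ} (hΦan : AnalyticAt ℂ Φ 0)
    (hplace : ∀ᶠ s in 𝓝[≠] (0 : ℂ),
      (F.map (Polynomial.evalRingHom (s ^ k)⁻¹)).eval (Φ s * (s ^ M)⁻¹) = 0) (G : ℂ[X][X]) :
    ∃ (ψ : ℂ → ℂ) (L : ℤ), AnalyticAt ℂ ψ 0 ∧ (¬ F ∣ G → ψ 0 ≠ 0) ∧
      ∀ᶠ s in 𝓝[≠] (0 : ℂ),
        (G.map (Polynomial.evalRingHom (s ^ k)⁻¹)).eval (Φ s * (s ^ M)⁻¹) = ψ s * s ^ L := by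
  by_cases hG : F ∣ G
  · obtain ⟨H, rfl⟩ := hG
    refine ⟨fun _ => 0, 0, analyticAt_const, fun h => (h ⟨H, rfl⟩).elim, ?_⟩
    filter_upwards [hplace] with s hs
    rw [Polynomial.map_mul, Polynomial.eval_mul, hs, zero_mul, zero_mul]
  · obtain ⟨ψ, L, hψan, hψ0, hev⟩ := exists_rows_place_normalForm F hFirr hn G hG hk M hΦan hplace
    exact ⟨ψ, L, hψan, fun _ => hψ0, hev⟩

/-- Clearing a pole: `s^N (ψ s^L) = ψ s^{(L + N).toNat}` for `s ≠ 0`, `0 ≤ L + N`. [folklore] -/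
theorem pow_mul_mul_zpow_eq {s : ℂ} (hs : s ≠ 0) (ψ : ℂ) {L : ℤ} {N : ℕ} (h : 0 ≤ L + N) :
    s ^ N * (ψ * s ^ L) = ψ * s ^ (L + N).toNat := by
  have h1 : (s ^ (L + N).toNat : ℂ) = s ^ L * s ^ N := by
    rw [← zpow_natCast, Int.toNat_of_nonneg h, zpow_add₀ hs, zpow_natCast]
  rw [h1]
  ring

/-- `ψ(s)s^n` with `ψ(0) ≠ 0` is not identically zero near `0`. [folklore] -/
theorem not_eventually_zero_of_row {Q ψ : ℂ → ℂ} (hψan : AnalyticAt ℂ ψ 0) (hψ0 : ψ 0 ≠ 0) {n : ℕ}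
    (hQ : ∀ᶠ s in 𝓝[≠] (0 : ℂ), Q s = ψ s * s ^ n) : ¬ ∀ᶠ s in 𝓝 (0 : ℂ), Q s = 0 := by
  intro h
  have h2 : ∀ᶠ s in 𝓝[≠] (0 : ℂ), False := by
    filter_upwards [hQ, nhdsWithin_le_nhds h, nhdsWithin_le_nhds (hψan.continuousAt.eventually_ne hψ0),
      self_mem_nhdsWithin] with s h1 h2 h3 h4
    rw [h2] at h1
    exact (mul_ne_zero h3 (pow_ne_zero _ h4)) h1.symm
  exact h2.exists.elim fun _ h => h

/-! ## Part B. The Puiseux parametrisation of a fibre curve along a place -/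

/-- **Puiseux root of a fibre curve along a place.**  `F` irreducible of positive `x₁`-degree; a
place `x₀ = s^{-k}`, `x₁ = Φ(s)s^{-M}` (`Φ` analytic, any `M`); `P ∈ ℂ[x₀][x₁][y]` of positive
`y`-degree with `F ∤` (top coefficient), `F ∤` (constant coefficient) and `F ∤ Res_y(P, ∂_yP)`.
Then there are `e ≥ 1`, `L ∈ ℤ`, `ψ` analytic at `0` with `ψ(0) ≠ 0`, and
`P(x₀(σ^e), x₁(σ^e); ψ(σ)σ^L) = 0` for all small `σ ≠ 0`. [folklore (Newton–Puiseux), made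
concrete] (new in this form) -/
theorem exists_fibreCurve_puiseuxRoot (hFirr : Irreducible F) (hn : 1 ≤ F.natDegree) {k : ℕ}
    (hk : 1 ≤ k) (M : ℕ) {Φ : ℂ → ℂ} (hΦan : AnalyticAt ℂ Φ 0)
    (hplace : ∀ᶠ s in 𝓝[≠] (0 : ℂ),
      (F.map (Polynomial.evalRingHom (s ^ k)⁻¹)).eval (Φ s * (s ^ M)⁻¹) = 0)
    (P : Polynomial ℂ[X][X]) (hd : 1 ≤ P.natDegree) (htop : ¬ F ∣ P.leadingCoeff)
    (hbot : ¬ F ∣ P.coeff 0)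
    (hdisc : ¬ F ∣ Polynomial.resultant P (derivative P) P.natDegree (P.natDegree - 1)) :
    ∃ (e : ℕ) (L : ℤ) (ψ : ℂ → ℂ), 1 ≤ e ∧ AnalyticAt ℂ ψ 0 ∧ ψ 0 ≠ 0 ∧
      ∀ᶠ σ in 𝓝[≠] (0 : ℂ),
        (P.map (Polynomial.eval₂RingHom (Polynomial.evalRingHom ((σ ^ e) ^ k)⁻¹)
          (Φ (σ ^ e) * ((σ ^ e) ^ M)⁻¹))).eval (ψ σ * σ ^ L) = 0 := by
  classical
  set d : ℕ := P.natDegree with hdP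
  -- the place evaluation homomorphism
  set φ : ℂ → (ℂ[X][X] →+* ℂ) := fun s =>
    Polynomial.eval₂RingHom (Polynomial.evalRingHom (s ^ k)⁻¹) (Φ s * (s ^ M)⁻¹) with hφ
  have hφev : ∀ s (G : ℂ[X][X]),
      φ s G = (G.map (Polynomial.evalRingHom (s ^ k)⁻¹)).eval (Φ s * (s ^ M)⁻¹) := by
    intro s G
    rw [hφ]
    simp only [Polynomial.coe_eval₂RingHom, Polynomial.eval_map]
  -- Bézout: `P·p + ∂P·q = C res`
  obtain ⟨p, q, -, -, hpq⟩ := Polynomial.exists_mul_add_mul_eq_C_resultant P (derivative P)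
    (m := d) (n := d - 1) (le_of_eq hdP.symm)
    ((Polynomial.natDegree_derivative_le P).trans (by rw [← hdP])) (Or.inl (by omega))
  set res : ℂ[X][X] := Polynomial.resultant P (derivative P) d (d - 1) with hres
  set dA : ℕ := max p.natDegree q.natDegree with hdA
  -- rows along the place
  have hrow := exists_row_along_place F hFirr hn hk M hΦan hplace
  choose ψP LP hψPan hψP0 hψPev using fun j => hrow (P.coeff j)
  choose ψp Lp hψpan hψp0 hψpev using fun i => hrow (p.coeff i)
  choose ψq Lq hψqan hψq0 hψqev using fun i => hrow (q.coeff i)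
  obtain ⟨ψr, Lr, hψran, hψr0, hψrev⟩ := hrow res
  -- clearing exponents
  set N : ℕ := (Finset.range (d + 1)).sup fun j => (-LP j).toNat with hN
  set NA : ℕ := ((Finset.range (dA + 1)).sup fun i => max (-Lp i).toNat (-Lq i).toNat) +
    (-Lr).toNat with hNA
  have hNj : ∀ j ∈ Finset.range (d + 1), 0 ≤ LP j + N := by
    intro j hj
    have h1 : (-LP j).toNat ≤ N := Finset.le_sup (f := fun j => (-LP j).toNat) hj
    have h2 := Int.self_le_toNat (-LP j)
    omega
  have hNAp : ∀ i ∈ Finset.range (dA + 1), 0 ≤ Lp i + NA := by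
    intro i hi
    have h1 : max (-Lp i).toNat (-Lq i).toNat ≤ (Finset.range (dA + 1)).sup
        fun i => max (-Lp i).toNat (-Lq i).toNat :=
      Finset.le_sup (f := fun i => max (-Lp i).toNat (-Lq i).toNat) hi
    have h2 := Int.self_le_toNat (-Lp i)
    have h3 := le_max_left (-Lp i).toNat (-Lq i).toNat
    omega
  have hNAq : ∀ i ∈ Finset.range (dA + 1), 0 ≤ Lq i + NA := by
    intro i hi
    have h1 : max (-Lp i).toNat (-Lq i).toNat ≤ (Finset.range (dA + 1)).sup
        fun i => max (-Lp i).toNat (-Lq i).toNat :=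
      Finset.le_sup (f := fun i => max (-Lp i).toNat (-Lq i).toNat) hi
    have h2 := Int.self_le_toNat (-Lq i)
    have h3 := le_max_right (-Lp i).toNat (-Lq i).toNat
    omega
  have hNr : 0 ≤ Lr + (N + NA : ℕ) := by
    have h2 := Int.self_le_toNat (-Lr)
    push_cast
    omega
  -- the analytic rows
  set Q : ℕ → ℂ → ℂ := fun j s => ψP j s * s ^ (LP j + N).toNat with hQ
  set A : ℕ → ℂ → ℂ := fun i s => ψp i s * s ^ (Lp i + NA).toNat with hA
  set B : ℕ → ℂ → ℂ := fun i s => ψq i s * s ^ (Lq i + NA).toNat with hB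
  set r : ℂ → ℂ := fun s => ψr s * s ^ (Lr + (N + NA : ℕ)).toNat with hr
  have hQan : ∀ j, AnalyticAt ℂ (Q j) 0 := fun j => (hψPan j).mul (analyticAt_id.pow _)
  have hAan : ∀ i, AnalyticAt ℂ (A i) 0 := fun i => (hψpan i).mul (analyticAt_id.pow _)
  have hBan : ∀ i, AnalyticAt ℂ (B i) 0 := fun i => (hψqan i).mul (analyticAt_id.pow _)
  have hran : AnalyticAt ℂ r 0 := hψran.mul (analyticAt_id.pow _)
  have hQd : ¬ ∀ᶠ s in 𝓝 (0 : ℂ), Q d s = 0 :=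
    not_eventually_zero_of_row (hψPan d) (hψP0 d (by rw [Polynomial.coeff_natDegree]; exact htop))
      (Filter.Eventually.of_forall fun s => rfl)
  have hQ0 : ¬ ∀ᶠ s in 𝓝 (0 : ℂ), Q 0 s = 0 :=
    not_eventually_zero_of_row (hψPan 0) (hψP0 0 hbot) (Filter.Eventually.of_forall fun s => rfl)
  have hr0 : ¬ ∀ᶠ s in 𝓝 (0 : ℂ), r s = 0 :=
    not_eventually_zero_of_row hψran (hψr0 hdisc) (Filter.Eventually.of_forall fun s => rfl)
  -- the row identities along the place (all at once)
  have hPdeg : P.natDegree ≤ d := le_of_eq hdP.symm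
  have hpdeg : p.natDegree ≤ dA := le_max_left _ _
  have hqdeg : q.natDegree ≤ dA := le_max_right _ _
  have hallP : ∀ᶠ s in 𝓝[≠] (0 : ℂ), ∀ j ∈ Finset.range (d + 1),
      φ s (P.coeff j) = ψP j s * s ^ LP j := by
    refine (Finset.eventually_all (Finset.range (d + 1))).2 fun j _ => ?_
    filter_upwards [hψPev j] with s hs
    rw [hφev]; exact hs
  have hallp : ∀ᶠ s in 𝓝[≠] (0 : ℂ), ∀ i ∈ Finset.range (dA + 1),
      φ s (p.coeff i) = ψp i s * s ^ Lp i := by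
    refine (Finset.eventually_all (Finset.range (dA + 1))).2 fun i _ => ?_
    filter_upwards [hψpev i] with s hs
    rw [hφev]; exact hs
  have hallq : ∀ᶠ s in 𝓝[≠] (0 : ℂ), ∀ i ∈ Finset.range (dA + 1),
      φ s (q.coeff i) = ψq i s * s ^ Lq i := by
    refine (Finset.eventually_all (Finset.range (dA + 1))).2 fun i _ => ?_
    filter_upwards [hψqev i] with s hs
    rw [hφev]; exact hs
  have hbez : ∀ᶠ s in 𝓝[≠] (0 : ℂ), ∀ y : ℂ,
      (∑ i ∈ Finset.range (dA + 1), A i s * y ^ i) *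
          (∑ j ∈ Finset.range (d + 1), Q j s * y ^ j) +
        (∑ i ∈ Finset.range (dA + 1), B i s * y ^ i) *
          (∑ j ∈ Finset.range (d + 1), (j : ℂ) * Q j s * y ^ (j - 1)) = r s := by
    filter_upwards [hallP, hallp, hallq, hψrev, self_mem_nhdsWithin] with s hP hp hq hresv hs0
    replace hs0 : s ≠ 0 := hs0
    intro y
    -- the four sums as `s`-multiples of the evaluations
    have eQ : ∑ j ∈ Finset.range (d + 1), Q j s * y ^ j = s ^ N * (P.map (φ s)).eval y := by
      rw [eval_map_eq_rowSum P (φ s) hPdeg, Finset.mul_sum]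
      refine Finset.sum_congr rfl fun j hj => ?_
      rw [hP j hj, hQ]
      simp only
      rw [← pow_mul_mul_zpow_eq hs0 (ψP j s) (hNj j hj)]
      ring
    have eQ' : ∑ j ∈ Finset.range (d + 1), (j : ℂ) * Q j s * y ^ (j - 1) =
        s ^ N * ((derivative P).map (φ s)).eval y := by
      rw [eval_derivative_map_eq_rowSum P (φ s) hPdeg, Finset.mul_sum]
      refine Finset.sum_congr rfl fun j hj => ?_
      rw [hP j hj, hQ]
      simp only
      rw [← pow_mul_mul_zpow_eq hs0 (ψP j s) (hNj j hj)]
      ring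
    have eA : ∑ i ∈ Finset.range (dA + 1), A i s * y ^ i = s ^ NA * (p.map (φ s)).eval y := by
      rw [eval_map_eq_rowSum p (φ s) hpdeg, Finset.mul_sum]
      refine Finset.sum_congr rfl fun i hi => ?_
      rw [hp i hi, hA]
      simp only
      rw [← pow_mul_mul_zpow_eq hs0 (ψp i s) (hNAp i hi)]
      ring
    have eB : ∑ i ∈ Finset.range (dA + 1), B i s * y ^ i = s ^ NA * (q.map (φ s)).eval y := by
      rw [eval_map_eq_rowSum q (φ s) hqdeg, Finset.mul_sum]
      refine Finset.sum_congr rfl fun i hi => ?_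
      rw [hq i hi, hB]
      simp only
      rw [← pow_mul_mul_zpow_eq hs0 (ψq i s) (hNAq i hi)]
      ring
    have er : r s = s ^ (N + NA) * φ s res := by
      rw [hφev, hresv, hr]
      simp only
      rw [← pow_mul_mul_zpow_eq hs0 (ψr s) hNr]
    -- Bézout evaluated
    have hb := congrArg (fun T : Polynomial ℂ[X][X] => (T.map (φ s)).eval y) hpq
    simp only [Polynomial.map_add, Polynomial.map_mul, Polynomial.eval_add, Polynomial.eval_mul,
      Polynomial.map_C, Polynomial.eval_C] at hb
    rw [eQ, eQ', eA, eB, er, ← hb, pow_add]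
    ring
  -- the analytic Newton–Puiseux theorem
  obtain ⟨e, L, ψ, he, hψan, hψ0, hroot⟩ := exists_puiseuxRoot_analyticRows d hd Q hQan hQd hQ0 dA
    A B hAan hBan r hran hr0 hbez
  refine ⟨e, L, ψ, he, hψan, hψ0, ?_⟩
  have hpowT : Tendsto (fun σ : ℂ => σ ^ e) (𝓝[≠] (0 : ℂ)) (𝓝[≠] (0 : ℂ)) :=
    tendsto_nhdsWithin_iff.2 ⟨(tendsto_pow_nhds_zero e he).mono_left nhdsWithin_le_nhds,
      eventually_nhdsWithin_of_forall fun σ hσ => pow_ne_zero _ hσ⟩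
  filter_upwards [hroot, hpowT.eventually hallP, hpowT.eventually self_mem_nhdsWithin]
    with σ hσ hP hs0
  replace hs0 : σ ^ e ≠ 0 := hs0
  have eQ : ∑ j ∈ Finset.range (d + 1), Q j (σ ^ e) * (ψ σ * σ ^ L) ^ j =
      (σ ^ e) ^ N * (P.map (φ (σ ^ e))).eval (ψ σ * σ ^ L) := by
    rw [eval_map_eq_rowSum P (φ (σ ^ e)) hPdeg, Finset.mul_sum]
    refine Finset.sum_congr rfl fun j hj => ?_
    rw [hP j hj, hQ]
    simp only
    rw [← pow_mul_mul_zpow_eq hs0 (ψP j (σ ^ e)) (hNj j hj)]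
    ring
  rw [eQ] at hσ
  exact (mul_eq_zero.1 hσ).resolve_left (pow_ne_zero _ hs0)

end FibreCurvePuiseux

end Summit.Schanuel.Schanuel.Theorems
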